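import Summits.AnomalousDissipation.AnomalousDissipation.Theorems.TwoAndHalfDTwohalfdNegCondensateSelection
import Literature.Analysis.FluidPDE.TimeAverageMeasureBasic

/-!
# Regular-condensate theorem for the crux `TwoAndHalfD.TwohalfdNeg` (stmt-AnomalousDissipation-0211):
# stub RC-SEL `stub_rcSelection` — good blocks

Line `log-kantorovich-enstrophy-transfer`, lead c7 (block architecture: good blocks → restart → Arzelà–Ascoli
+ weak `L²` limits → sourced transport → conservative balance → ODE endgame). This file closes the registered
stub RC-SEL. Fix one level: `κ > 0`, a global planar Leray–Hopf flow `v` under a steady smooth mean-zero force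
`g`, a global weak sourced scalar `θ` over it (steady smooth mean-zero source `h`, `L²` datum), a bounded jointly
continuous comparison flow `W`, a block length `S > 0`, a floor `2ε < ⟨κ‖∇θ‖²⟩`, ceilings `⟨‖θ‖²⟩ < Eθ`,
`⟨∫‖v - W‖²⟩ < δ`, and a conull set `G ⊆ (0, ∞)` of admissible starting times. Then some block `(a, a + S]`,
`a ∈ G`, has power `≥ εS/2`, variance mass `≤ λ Eθ S`, fluctuation mass `≤ λ δ S` and starting variance
`‖θ(a)‖² ≤ λ Eθ`, `λ = 64 (∫h²) Eθ/ε² + 4`.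

Proof. (1) Real-variable half (`Selection.exists_good_block`, PDE-free): for `P` (power), `E ≥ 0` (variance),
`F ≥ 0` (fluctuation) integrable on every `(0, T]`, the block functionals `X(a) = ∫_{(a,a+S]} P`, `V`, `Fl` are,
after `t = a + S`, the backward windows of `FluidPDE/AgeDecouplingWindows`; hence `∫₀ᴺ V ≤ S∫₀^{N+S} E`,
`∫₀ᴺ Fl ≤ S∫₀^{N+S} F` and, through the primitive identity `∫_S^T∫_{t-S}^t P = ∫_{T-S}^T Π - ∫₀^S Π`
(`Π = ∫₀ P`), `∫₀ᴺ X ≥ S · min_{[N,N+S]} Π - ∫₀^S Π`. The PENALISED functional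
`Ψ = X - (ε/4Eθ)V - (ε/4δ)Fl - (εS/4Eθ)E` then has `∫₀ᴺ Ψ > (εS/2)N`, so `Ψ > εS/2` on a set of positive
measure, which meets `G`; there the floor holds and, with the block Cauchy–Schwarz bound `X² ≤ S(∫h²)V`
(`sq_block_le`, from `P² ≤ (∫h²)E` a.e.), the ceilings follow with constants `16(∫h²)Eθ/ε² ≤ λ`
(`good_of_penalized`). No bad set, no Chebyshev. (2) PDE inputs: `P`, `E = ‖θ‖²`, `q = κ‖∇θ‖²`
(`FluidPDE/SourcedScalarBudget`) and `F = ∫‖v - W‖²` (jointly measurable; bounded through the honest `L^∞L²`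
bound `Torus.IsGlobalLerayHopf.exists_forall_integral_norm_sq_le_of_hasZeroMean`) are integrable on every
`(0, T]`; `(H1)` `∫₀ᵗ q ≤ ½∫θ₀² + ∫₀ᵗ P` (the trace is `P` a.e.) gives `Π ≥ ∫₀ᴺ q - ½∫θ₀² ≥ 2εN - ½∫θ₀²` on
`[N, N+S]` at a horizon `N` with `timeMean q N > 2ε`; the three running means are honest, so such `N` exist
beyond any threshold with the variance / fluctuation means below their ceilings at `N` and `N + S`.
Supports stmt-AnomalousDissipation-0211. [cite: DoeringFoias2002, §2] for the budgets; the rest is [folklore].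
-/

namespace Summit.AnomalousDissipation.AnomalousDissipation.Theorems.TwohalfdNeg.RegularCondensate

open MeasureTheory Filter Topology Set
open scoped ENNReal NNReal InnerProductSpace
open Literature.Analysis.FunctionSpaces Literature.Analysis.FluidPDE

-- `Summit.<Summit>.<Problem>` is the mandated summit-side namespace (CONVENTIONS §2); for this single-conjunct
-- summit the two components coincide, so the duplicate namespace is deliberate.
set_option linter.dupNamespace false

namespace Selection

/-! ## Real-variable half: blocks `(a, a + S]` as backward windows, penalised selection -/

section Blocks

variable {f : ℝ → ℝ} {S : ℝ}

/-- A block integral over `(a, a+S]` is the backward window of length `S` ending at `a + S`. [folklore] -/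
theorem block_eq_window (hS : 0 ≤ S) (a : ℝ) : ∫ t in Ioc a (a + S), f t = ∫ s in (a + S - S)..(a + S), f s := by
  rw [add_sub_cancel_right, intervalIntegral.integral_of_le (le_add_of_nonneg_right hS)]

/-- The block integral `a ↦ ∫_{(a,a+S]} f` of a function integrable on every `(0, T]` is continuous on `[0, N]`.
[folklore] -/
theorem continuousOn_block (hf : ∀ T, IntegrableOn f (Ioc 0 T)) (hS : 0 ≤ S) (N : ℝ) :
    ContinuousOn (fun a => ∫ t in Ioc a (a + S), f t) (Icc 0 N) := by
  have hmaps : MapsTo (fun a : ℝ => a + S) (Icc 0 N) (Icc S (N + S)) := fun a ha =>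
    ⟨le_add_of_nonneg_left ha.1, by linarith [ha.2]⟩
  exact ((AgeDecoupling.continuousOn_window hf hS (N + S)).comp (continuousOn_id.add continuousOn_const)
    hmaps).congr fun a _ => block_eq_window hS a

/-- The block integral is interval integrable in the starting time on `[0, N]`. [folklore] -/
theorem intervalIntegrable_block (hf : ∀ T, IntegrableOn f (Ioc 0 T)) (hS : 0 ≤ S) {N : ℝ} (hN : 0 ≤ N) :
    IntervalIntegrable (fun a => ∫ t in Ioc a (a + S), f t) volume 0 N :=
  (intervalIntegrable_iff_integrableOn_Ioc_of_le hN).2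
    (((continuousOn_block hf hS N).integrableOn_Icc).mono_set Ioc_subset_Icc_self)

/-- **Sliding blocks are sliding windows**: `∫₀ᴺ (∫_{(a,a+S]} f) da = ∫_S^{N+S} (∫_{t-S}^t f) dt`. [folklore] -/
theorem integral_block_eq_integral_window (hS : 0 ≤ S) (N : ℝ) :
    ∫ a in (0 : ℝ)..N, (∫ t in Ioc a (a + S), f t) = ∫ t in S..(N + S), (∫ s in (t - S)..t, f s) := by
  have h := intervalIntegral.integral_comp_add_right (fun t => ∫ s in (t - S)..t, f s) S (a := 0) (b := N)
  rw [zero_add] at h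
  rw [← h]
  exact intervalIntegral.integral_congr fun a _ => block_eq_window hS a

/-- **Averaged blocks of a nonnegative function**: `∫₀ᴺ (∫_{(a,a+S]} f) da ≤ S ∫₀^{N+S} f` for `f ≥ 0`. [folklore] -/
theorem integral_block_le (hf : ∀ T, IntegrableOn f (Ioc 0 T)) (hf0 : ∀ t, 0 ≤ f t) (hS : 0 ≤ S) {N : ℝ}
    (hN : 0 ≤ N) : ∫ a in (0 : ℝ)..N, (∫ t in Ioc a (a + S), f t) ≤ S * ∫ t in (0 : ℝ)..(N + S), f t := by
  rw [integral_block_eq_integral_window hS N]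
  exact AgeDecoupling.integral_window_le hf hf0 hS (by linarith)

/-- **Averaged blocks of a signed function with a primitive floor**: if `m ≤ ∫₀ᵗ P` on `[N, N + S]`, then
`S m - ∫₀^S Π ≤ ∫₀ᴺ (∫_{(a,a+S]} P) da`, `Π(t) = ∫₀ᵗ P` (primitive identity for integrated windows). [folklore] -/
theorem le_integral_block {P : ℝ → ℝ} {m : ℝ} (hP : ∀ T, IntegrableOn P (Ioc 0 T)) (hS : 0 ≤ S) {N : ℝ}
    (hN : 0 ≤ N) (hm : ∀ t ∈ Icc N (N + S), m ≤ ∫ s in (0 : ℝ)..t, P s) :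
    S * m - ∫ t in (0 : ℝ)..S, (∫ s in (0 : ℝ)..t, P s) ≤ ∫ a in (0 : ℝ)..N, (∫ t in Ioc a (a + S), P t) := by
  rw [integral_block_eq_integral_window hS N, AgeDecoupling.integral_window_eq hP hS (by linarith), add_sub_cancel_right]
  have h1 : ∫ _ in N..(N + S), m ≤ ∫ t in N..(N + S), (∫ s in (0 : ℝ)..t, P s) :=
    intervalIntegral.integral_mono_on (by linarith) intervalIntegrable_const
      (AgeDecoupling.intervalIntegrable_primitive hP hN (by linarith)) hm
  rw [intervalIntegral.integral_const, smul_eq_mul, add_sub_cancel_left] at h1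
  linarith

/-- **Block Cauchy–Schwarz from the a.e. bound `P² ≤ H E`**: `(∫_{(a,a+S]} P)² ≤ S · H · ∫_{(a,a+S]} E` for
`a ≥ 0`. [folklore] -/
theorem sq_block_le {P E : ℝ → ℝ} {H : ℝ} (hP : ∀ T, IntegrableOn P (Ioc 0 T)) (hE : ∀ T, IntegrableOn E (Ioc 0 T))
    (hPE : ∀ᵐ t ∂(volume.restrict (Ioi (0 : ℝ))), P t ^ 2 ≤ H * E t) (hS : 0 ≤ S) {a : ℝ} (ha : 0 ≤ a) :
    (∫ t in Ioc a (a + S), P t) ^ 2 ≤ S * H * ∫ t in Ioc a (a + S), E t := by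
  -- `|P|²` is integrable on every `(0, T]`, dominated by `H E`
  have hP2 : ∀ T, IntegrableOn (fun t => |P t| ^ 2) (Ioc 0 T) := fun T => by
    refine Integrable.mono' ((hE T).const_mul H) (((hP T).aestronglyMeasurable.norm).pow 2) ?_
    filter_upwards [ae_restrict_of_ae_restrict_of_subset Ioc_subset_Ioi_self hPE] with t ht
    rwa [Real.norm_eq_abs, abs_pow, abs_abs, sq_abs]
  have h1 := AgeDecoupling.sq_window_le (fun T => (hP T).abs) hP2 (fun t => abs_nonneg _) hS
    (le_add_of_nonneg_left ha : S ≤ a + S)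
  rw [add_sub_cancel_right, intervalIntegral.integral_of_le (le_add_of_nonneg_right hS),
    intervalIntegral.integral_of_le (le_add_of_nonneg_right hS)] at h1
  have hsub : Ioc a (a + S) ⊆ Ioi 0 := fun t ht => ha.trans_lt ht.1
  have hsub' : Ioc a (a + S) ⊆ Ioc 0 (a + S) := Ioc_subset_Ioc_left ha
  have h2 : ∫ t in Ioc a (a + S), |P t| ^ 2 ≤ ∫ t in Ioc a (a + S), H * E t := by
    refine integral_mono_ae ((hP2 (a + S)).mono_set hsub') (((hE (a + S)).mono_set hsub').const_mul H) ?_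
    filter_upwards [ae_restrict_of_ae_restrict_of_subset hsub hPE] with t ht
    rwa [sq_abs]
  rw [integral_const_mul] at h2
  calc (∫ t in Ioc a (a + S), P t) ^ 2 = |∫ t in Ioc a (a + S), P t| ^ 2 := (sq_abs _).symm
    _ ≤ (∫ t in Ioc a (a + S), |P t|) ^ 2 := pow_le_pow_left₀ (abs_nonneg _) abs_integral_le_integral_abs 2
    _ ≤ S * ∫ t in Ioc a (a + S), |P t| ^ 2 := h1
    _ ≤ S * (H * ∫ t in Ioc a (a + S), E t) := mul_le_mul_of_nonneg_left h2 hS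
    _ = S * H * ∫ t in Ioc a (a + S), E t := by ring

end Blocks

/-- Real arithmetic of one good starting time: if `X > εS/2 + (ε/4Eθ) V + (ε/4δ) Fl + (εS/4Eθ) Z` with
`V, Fl, Z ≥ 0` and `X² ≤ S H V`, then `X ≥ εS/2`, `V ≤ 16 S H Eθ²/ε²`, `Fl ≤ 16 S H Eθ δ/ε²`, `Z ≤ 16 H Eθ²/ε²`.
[folklore] -/
theorem good_of_penalized {X V Fl Z S H ε Eθ δ : ℝ} (hS : 0 < S) (hε : 0 < ε) (hEθ : 0 < Eθ) (hδ : 0 < δ)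
    (hH : 0 ≤ H) (hV : 0 ≤ V) (hFl : 0 ≤ Fl) (hZ : 0 ≤ Z)
    (hΨ : ε * S / 2 < X - ε / (4 * Eθ) * V - ε / (4 * δ) * Fl - ε * S / (4 * Eθ) * Z) (hCS : X ^ 2 ≤ S * H * V) :
    ε / 2 * S ≤ X ∧ V ≤ 16 * S * H * Eθ ^ 2 / ε ^ 2 ∧ Fl ≤ 16 * S * H * Eθ * δ / ε ^ 2 ∧
      Z ≤ 16 * H * Eθ ^ 2 / ε ^ 2 := by
  have h1 : 0 ≤ ε / (4 * Eθ) * V := by positivity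
  have h2 : 0 ≤ ε / (4 * δ) * Fl := by positivity
  have h3 : 0 ≤ ε * S / (4 * Eθ) * Z := by positivity
  have hεS : 0 < ε * S := mul_pos hε hS
  have hX0 : 0 ≤ X := by linarith
  -- the scale `M = S H (4Eθ/ε)`: with `t = (ε/4Eθ) V ≤ X` and `X² ≤ S H V = M t` we get `t ≤ M` and `X ≤ M`
  set M : ℝ := S * H * (4 * Eθ / ε) with hM
  have hM0 : 0 ≤ M := by positivity
  have ht : ε / (4 * Eθ) * V ≤ X := by linarith
  have hXt : X ^ 2 ≤ M * (ε / (4 * Eθ) * V) := by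
    calc X ^ 2 ≤ S * H * V := hCS
      _ = S * H * (4 * Eθ / ε) * (ε / (4 * Eθ) * V) := by field_simp
  have htM : ε / (4 * Eθ) * V ≤ M := by
    rcases h1.eq_or_lt with h0 | hpos
    · rw [← h0]; exact hM0
    · have : (ε / (4 * Eθ) * V) * (ε / (4 * Eθ) * V) ≤ M * (ε / (4 * Eθ) * V) := by
        nlinarith [pow_le_pow_left₀ h1 ht 2]
      exact le_of_mul_le_mul_right this hpos
  have hXM : X ≤ M := (pow_le_pow_iff_left₀ hX0 hM0 two_ne_zero).1 (by nlinarith)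
  refine ⟨by linarith, ?_, ?_, ?_⟩
  · calc V = 4 * Eθ / ε * (ε / (4 * Eθ) * V) := by field_simp
      _ ≤ 4 * Eθ / ε * M := mul_le_mul_of_nonneg_left htM (by positivity)
      _ = 16 * S * H * Eθ ^ 2 / ε ^ 2 := by rw [hM]; field_simp; ring
  · calc Fl = 4 * δ / ε * (ε / (4 * δ) * Fl) := by field_simp
      _ ≤ 4 * δ / ε * M := mul_le_mul_of_nonneg_left (by linarith) (by positivity)
      _ = 16 * S * H * Eθ * δ / ε ^ 2 := by rw [hM]; field_simp; ring
  · calc Z = 4 * Eθ / (ε * S) * (ε * S / (4 * Eθ) * Z) := by field_simp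
      _ ≤ 4 * Eθ / (ε * S) * M := mul_le_mul_of_nonneg_left (by linarith) (by positivity)
      _ = 16 * H * Eθ ^ 2 / ε ^ 2 := by rw [hM]; field_simp; ring

/-- **Penalised sliding-block selection.** `P`, `E ≥ 0`, `F ≥ 0` integrable on every `(0, T]`; the block
Cauchy–Schwarz bound `(∫_{(a,a+S]} P)² ≤ S H ∫_{(a,a+S]} E` (`a ≥ 0`); a horizon `N > 0` with the primitive floor
`2εN - C₀ ≤ ∫₀ᵗ P` on `[N, N+S]`, `∫₀ᴺ E ≤ Eθ N`, `∫₀^{N+S} E ≤ Eθ (N+S)`, `∫₀^{N+S} F ≤ δ (N+S)` and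
`εS²/2 + S C₀ + |∫₀^S Π| < (3/4) ε S N`; a conull `G ⊆ (0,∞)`. Then some `a ∈ G`, `a > 0`, opens a good block:
`∫_{(a,a+S]} P ≥ εS/2`, `∫_{(a,a+S]} E ≤ 16 S H Eθ²/ε²`, `∫_{(a,a+S]} F ≤ 16 S H Eθ δ/ε²`, `E(a) ≤ 16 H Eθ²/ε²`. [folklore] -/
theorem exists_good_block {P E F : ℝ → ℝ} {G : Set ℝ} {S N ε Eθ δ C₀ H : ℝ} (hS : 0 < S) (hN : 0 < N)
    (hε : 0 < ε) (hEθ : 0 < Eθ) (hδ : 0 < δ) (hH : 0 ≤ H) (hPi : ∀ T, IntegrableOn P (Ioc 0 T))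
    (hEi : ∀ T, IntegrableOn E (Ioc 0 T)) (hFi : ∀ T, IntegrableOn F (Ioc 0 T)) (hE0 : ∀ t, 0 ≤ E t)
    (hF0 : ∀ t, 0 ≤ F t) (hCS : ∀ a, 0 ≤ a → (∫ t in Ioc a (a + S), P t) ^ 2 ≤ S * H * ∫ t in Ioc a (a + S), E t)
    (hfloor : ∀ t ∈ Icc N (N + S), 2 * ε * N - C₀ ≤ ∫ s in (0 : ℝ)..t, P s) (hEN : ∫ s in (0 : ℝ)..N, E s ≤ Eθ * N)
    (hET : ∫ s in (0 : ℝ)..(N + S), E s ≤ Eθ * (N + S)) (hFT : ∫ s in (0 : ℝ)..(N + S), F s ≤ δ * (N + S))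
    (hlarge : ε * S ^ 2 / 2 + S * C₀ + |∫ t in (0 : ℝ)..S, ∫ s in (0 : ℝ)..t, P s| < 3 / 4 * ε * S * N)
    (hG : ∀ᵐ a ∂(volume.restrict (Ioi (0 : ℝ))), a ∈ G) :
    ∃ a ∈ G, 0 < a ∧ ε / 2 * S ≤ ∫ t in Ioc a (a + S), P t ∧ ∫ t in Ioc a (a + S), E t ≤ 16 * S * H * Eθ ^ 2 / ε ^ 2 ∧
      ∫ t in Ioc a (a + S), F t ≤ 16 * S * H * Eθ * δ / ε ^ 2 ∧ E a ≤ 16 * H * Eθ ^ 2 / ε ^ 2 := by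
  set μ₁ : ℝ := ε / (4 * Eθ) with hμ₁
  set μ₂ : ℝ := ε / (4 * δ) with hμ₂
  set μ₃ : ℝ := ε * S / (4 * Eθ) with hμ₃
  have iX := intervalIntegrable_block hPi hS.le hN.le
  have iV := intervalIntegrable_block hEi hS.le hN.le
  have iF := intervalIntegrable_block hFi hS.le hN.le
  have iZ : IntervalIntegrable E volume 0 N := AgeDecoupling.intervalIntegrable_of_forall_integrableOn hEi le_rfl hN.le
  -- the averaged bounds and the integral of the penalised functional
  have bX := le_integral_block hPi hS.le hN.le hfloor
  have bV := integral_block_le hEi hE0 hS.le hN.le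
  have bF := integral_block_le hFi hF0 hS.le hN.le
  have hΨ : ∫ a in (0 : ℝ)..N, ((∫ t in Ioc a (a + S), P t) - μ₁ * (∫ t in Ioc a (a + S), E t) -
      μ₂ * (∫ t in Ioc a (a + S), F t) - μ₃ * E a) =
      (∫ a in (0 : ℝ)..N, ∫ t in Ioc a (a + S), P t) - μ₁ * (∫ a in (0 : ℝ)..N, ∫ t in Ioc a (a + S), E t) -
        μ₂ * (∫ a in (0 : ℝ)..N, ∫ t in Ioc a (a + S), F t) - μ₃ * ∫ a in (0 : ℝ)..N, E a := by
    rw [intervalIntegral.integral_sub ((iX.sub (iV.const_mul μ₁)).sub (iF.const_mul μ₂)) (iZ.const_mul μ₃),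
      intervalIntegral.integral_sub (iX.sub (iV.const_mul μ₁)) (iF.const_mul μ₂),
      intervalIntegral.integral_sub iX (iV.const_mul μ₁), intervalIntegral.integral_const_mul,
      intervalIntegral.integral_const_mul, intervalIntegral.integral_const_mul]
  have hpen : μ₁ * (∫ a in (0 : ℝ)..N, ∫ t in Ioc a (a + S), E t) + μ₂ * (∫ a in (0 : ℝ)..N, ∫ t in Ioc a (a + S), F t) +
      μ₃ * (∫ a in (0 : ℝ)..N, E a) ≤ 3 / 4 * ε * S * N + ε * S ^ 2 / 2 := by
    have p1 : μ₁ * (∫ a in (0 : ℝ)..N, ∫ t in Ioc a (a + S), E t) ≤ μ₁ * (S * (Eθ * (N + S))) :=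
      mul_le_mul_of_nonneg_left (bV.trans (mul_le_mul_of_nonneg_left hET hS.le)) (by positivity)
    have p2 : μ₂ * (∫ a in (0 : ℝ)..N, ∫ t in Ioc a (a + S), F t) ≤ μ₂ * (S * (δ * (N + S))) :=
      mul_le_mul_of_nonneg_left (bF.trans (mul_le_mul_of_nonneg_left hFT hS.le)) (by positivity)
    have p3 : μ₃ * (∫ a in (0 : ℝ)..N, E a) ≤ μ₃ * (Eθ * N) := mul_le_mul_of_nonneg_left hEN (by positivity)
    have e : μ₁ * (S * (Eθ * (N + S))) + μ₂ * (S * (δ * (N + S))) + μ₃ * (Eθ * N) = 3 / 4 * ε * S * N + ε * S ^ 2 / 2 := by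
      rw [hμ₁, hμ₂, hμ₃]; field_simp; ring
    linarith
  have hK := le_abs_self (∫ t in (0 : ℝ)..S, ∫ s in (0 : ℝ)..t, P s)
  -- if no admissible starting time were good, `Ψ ≤ εS/2` a.e. on `(0, N]`, contradicting `∫₀ᴺ Ψ > (εS/2) N`
  by_contra hcon
  have hae : ∀ᵐ a ∂(volume.restrict (Ioc (0 : ℝ) N)), (∫ t in Ioc a (a + S), P t) -
      μ₁ * (∫ t in Ioc a (a + S), E t) - μ₂ * (∫ t in Ioc a (a + S), F t) - μ₃ * E a ≤ ε * S / 2 := by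
    filter_upwards [ae_restrict_of_ae_restrict_of_subset Ioc_subset_Ioi_self hG,
      ae_restrict_mem measurableSet_Ioc] with a haG ha
    by_contra hlt
    push Not at hlt
    obtain ⟨g1, g2, g3, g4⟩ := good_of_penalized hS hε hEθ hδ hH (setIntegral_nonneg measurableSet_Ioc fun t _ => hE0 t)
      (setIntegral_nonneg measurableSet_Ioc fun t _ => hF0 t) (hE0 a) hlt (hCS a ha.1.le)
    exact hcon ⟨a, haG, ha.1, g1, g2, g3, g4⟩
  have hup := intervalIntegral.integral_mono_ae_restrict hN.le
    (((iX.sub (iV.const_mul μ₁)).sub (iF.const_mul μ₂)).sub (iZ.const_mul μ₃)) intervalIntegrable_const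
    (by rwa [Measure.restrict_congr_set Ioc_ae_eq_Icc] at hae)
  rw [intervalIntegral.integral_const, smul_eq_mul, sub_zero, hΨ] at hup
  linarith

/-! ## PDE half: the fluctuation energy around a bounded continuous comparison flow -/

section Level

variable {κ : ℝ} {g v₀ : UnitAddTorus (Fin 2) → EuclideanSpace ℝ (Fin 2)} {v W : ℝ → UnitAddTorus (Fin 2) → EuclideanSpace ℝ (Fin 2)}
  {B : ℝ}

/-- **Honest bound of the fluctuation energy**: along a global Leray–Hopf flow under a steady smooth mean-zero
force, for a jointly continuous comparison flow `W` with `‖W‖ ≤ B`, some `R` bounds `∫‖v(t) - W(t)‖²` for every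
`t ≥ 0` (`‖a - b‖² ≤ 2‖a‖² + 2‖b‖²` and the uniform energy bound). [folklore] -/
theorem exists_forall_fluct_le (hκ : 0 < κ) (hgs : Torus.IsSmooth g) (hgz : Torus.HasZeroMean g)
    (hLH : Torus.IsGlobalLerayHopf κ (fun _ => g) v₀ v) (hW : Continuous (Function.uncurry W))
    (hWB : ∀ t x, ‖W t x‖ ≤ B) : ∃ R : ℝ, ∀ t, 0 ≤ t → ∫ x, ‖v t x - W t x‖ ^ 2 ≤ R := by
  obtain ⟨R, hR⟩ := hLH.exists_forall_integral_norm_sq_le_of_hasZeroMean hκ (hgs.memLp 2) hgz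
  refine ⟨2 * R + 2 * B ^ 2, fun t ht => ?_⟩
  have hWL2 : MemLp (W t) 2 volume := Condensate.FluctuationMeans.memLp_two_of_continuous (hW.uncurry_left t)
  have h1 := Condensate.FluctuationMeans.integral_norm_sub_sq_le_two_mul_add (hLH.memLp_two ht) hWL2
  have h2 : ∫ x, ‖W t x‖ ^ 2 ≤ B ^ 2 := by
    calc ∫ x, ‖W t x‖ ^ 2 ≤ ∫ _, B ^ 2 := integral_mono (hWL2.integrable_norm_pow two_ne_zero) (integrable_const _)
          fun x => pow_le_pow_left₀ (norm_nonneg _) (hWB t x) 2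
      _ = B ^ 2 := by simp only [integral_const, probReal_univ, one_smul]
  linarith [hR t ht]

/-- **The fluctuation energy is integrable on every `(0, T]`** (jointly measurable by Fubini, bounded). [folklore] -/
theorem integrableOn_fluct (hκ : 0 < κ) (hgs : Torus.IsSmooth g) (hgz : Torus.HasZeroMean g)
    (hLH : Torus.IsGlobalLerayHopf κ (fun _ => g) v₀ v) (hW : Continuous (Function.uncurry W))
    (hWB : ∀ t x, ‖W t x‖ ≤ B) (T : ℝ) : IntegrableOn (fun t => ∫ x, ‖v t x - W t x‖ ^ 2) (Ioc 0 T) := by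
  rcases le_or_gt T 0 with hT | hT
  · rw [Ioc_eq_empty (not_lt.2 hT)]; exact integrableOn_empty
  obtain ⟨R, hR⟩ := exists_forall_fluct_le hκ hgs hgz hLH hW hWB
  have hmeas : AEStronglyMeasurable (fun t => ∫ x, ‖v t x - W t x‖ ^ 2) (volume.restrict (Ioc 0 T)) := by
    have h1 : AEStronglyMeasurable (fun p : ℝ × UnitAddTorus (Fin 2) => ‖Function.uncurry v p - Function.uncurry W p‖ ^ 2)
        ((volume.restrict (Ioo 0 T)).prod volume) :=
      (continuous_pow 2).comp_aestronglyMeasurable ((hLH T hT).aestronglyMeasurable_uncurry.sub hW.aestronglyMeasurable).norm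
    have h2 : AEStronglyMeasurable (fun t => ∫ x, ‖v t x - W t x‖ ^ 2) (volume.restrict (Ioo 0 T)) :=
      h1.integral_prod_right'
    rwa [Measure.restrict_congr_set Ioo_ae_eq_Ioc] at h2
  refine Integrable.mono' (g := fun _ => R) (integrable_const _) hmeas ?_
  filter_upwards [ae_restrict_mem measurableSet_Ioc] with t ht
  rw [Real.norm_eq_abs, abs_of_nonneg (integral_nonneg fun x => sq_nonneg _)]
  exact hR t ht.1.le

end Level

end Selection

open Selection in
/-- **RC-SEL `stub_rcSelection` — good blocks** (registered stub of the line `log-kantorovich-enstrophy-transfer`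
on stmt-AnomalousDissipation-0211). At one level (`κ > 0`, global planar Leray–Hopf flow `v` under a steady smooth
mean-zero force, global weak sourced scalar `θ` with steady smooth mean-zero source `h` and `L²` datum, bounded
jointly continuous comparison flow `W`, block length `S > 0`, floor `2ε < ⟨κ‖∇θ‖²⟩`, ceilings `⟨‖θ‖²⟩ < Eθ`,
`⟨∫‖v - W‖²⟩ < δ`, conull admissible set `G ⊆ (0,∞)`), some block `(a, a+S]` with `a ∈ G`, `a > 0` has power
`≥ εS/2`, variance mass `≤ λ Eθ S`, fluctuation mass `≤ λ δ S` and starting variance `≤ λ Eθ`,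
`λ = 64 (∫h²) Eθ/ε² + 4`. Proof: honesty of the three running means picks a large horizon `N`; `(H1)`, `(H3)` of
`FluidPDE/SourcedScalarBudget` and the integrability of the four functionals feed the penalised sliding-block
selection `Selection.exists_good_block` (constants `16 (∫h²) Eθ/ε² ≤ λ`). [folklore] -/
theorem stub_rcSelection :
    ∀ (κ : ℝ) (g : UnitAddTorus (Fin 2) → EuclideanSpace ℝ (Fin 2))
      (v₀ : UnitAddTorus (Fin 2) → EuclideanSpace ℝ (Fin 2))
      (v : ℝ → UnitAddTorus (Fin 2) → EuclideanSpace ℝ (Fin 2))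
      (W : ℝ → UnitAddTorus (Fin 2) → EuclideanSpace ℝ (Fin 2))
      (h θ₀ : UnitAddTorus (Fin 2) → ℝ) (θ : ℝ → UnitAddTorus (Fin 2) → ℝ)
      (G : Set ℝ) (ε Eθ δ S B : ℝ),
      0 < κ → Torus.IsSmooth g → Torus.HasZeroMean g → Torus.IsGlobalLerayHopf κ (fun _ => g) v₀ v →
      Continuous (Function.uncurry W) → (∀ t x, ‖W t x‖ ≤ B) →
      Torus.IsSmooth h → Torus.HasZeroMean h → MemLp θ₀ 2 volume →
      Torus.IsWeakScalarTransportForced κ v (fun _ => h) θ₀ θ →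
      (∀ᵐ a ∂(volume.restrict (Set.Ioi (0 : ℝ))), a ∈ G) →
      0 < ε → 0 < S → 0 < δ →
      2 * ε < longTimeAvgSup (fun t => κ * (Torus.eScalarGradNormSq (θ t)).toReal) →
      longTimeAvgSup (fun t => Torus.scalarL2Sq (θ t)) < Eθ →
      longTimeAvgSup (fun t => ∫ x, ‖v t x - W t x‖ ^ 2) < δ →
      ∃ a ∈ G, 0 < a ∧
        ε / 2 * S ≤ ∫ t in Set.Ioc a (a + S), ∫ x, θ t x * h x ∧
        ∫ t in Set.Ioc a (a + S), Torus.scalarL2Sq (θ t) ≤ (64 * (∫ x, h x ^ 2) * Eθ / ε ^ 2 + 4) * Eθ * S ∧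
        ∫ t in Set.Ioc a (a + S), ∫ x, ‖v t x - W t x‖ ^ 2 ≤ (64 * (∫ x, h x ^ 2) * Eθ / ε ^ 2 + 4) * δ * S ∧
        Torus.scalarL2Sq (θ a) ≤ (64 * (∫ x, h x ^ 2) * Eθ / ε ^ 2 + 4) * Eθ := by
  intro κ g v₀ v W h θ₀ θ G ε Eθ δ S B hκ hgs hgz hLH hWc hWB hhs hhz hθ₀ hθ hG hε hS hδ hD hSlim hFlim
  have hG' : ∀ T, 0 < T → ∫⁻ t in Ioo 0 T, Torus.eGradNormSq (v t) ^ (1 / 2 : ℝ) < ⊤ := fun T hT =>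
    QuietOfSubLog.lintegral_rpow_half_eGradNormSq_lt_top hLH hT
  have hH0 : 0 ≤ ∫ y, h y ^ 2 := integral_nonneg fun _ => sq_nonneg _
  have hE0 : ∀ t, 0 ≤ Torus.scalarL2Sq (θ t) := fun t => Torus.scalarL2Sq_nonneg _
  have hF0 : ∀ t, 0 ≤ ∫ x, ‖v t x - W t x‖ ^ 2 := fun t => integral_nonneg fun _ => sq_nonneg _
  have hq0 : ∀ t, 0 ≤ κ * (Torus.eScalarGradNormSq (θ t)).toReal := fun t => mul_nonneg hκ.le ENNReal.toReal_nonneg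
  have hEθ : 0 < Eθ := (longTimeAvgSup_nonneg hE0).trans_lt hSlim
  -- integrability on every `(0, T]` of the power, the variance, the fluctuation and the dissipation rate
  have hPi : ∀ T, IntegrableOn (fun t => ∫ x, θ t x * h x) (Ioc 0 T) := fun T => by
    rcases le_or_gt T 0 with hT | hT
    · rw [Ioc_eq_empty (not_lt.2 hT)]; exact integrableOn_empty
    exact (intervalIntegrable_iff_integrableOn_Ioc_of_le hT.le).1 (Condensate.intervalIntegrable_integral_mul hθ hhs.continuous hT)
  have hEi : ∀ T, IntegrableOn (fun t => Torus.scalarL2Sq (θ t)) (Ioc 0 T) := fun T => by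
    rcases le_or_gt T 0 with hT | hT
    · rw [Ioc_eq_empty (not_lt.2 hT)]; exact integrableOn_empty
    exact (Torus.integrableOn_scalarL2Sq hθ hT).1
  have hFi := fun T => integrableOn_fluct hκ hgs hgz hLH hWc hWB T
  have hqi : ∀ T, IntegrableOn (fun t => κ * (Torus.eScalarGradNormSq (θ t)).toReal) (Ioc 0 T) := fun T => by
    rcases le_or_gt T 0 with hT | hT
    · rw [Ioc_eq_empty (not_lt.2 hT)]; exact integrableOn_empty
    exact (Torus.integrableOn_dissipationRate hκ hθ hθ₀ hhs hG' hT).1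
  -- `(H3)`: `P² ≤ (∫h²) ‖θ‖²` a.e. (the trace is the power a.e.)
  have hPE : ∀ᵐ t ∂(volume.restrict (Ioi (0 : ℝ))), (∫ x, θ t x * h x) ^ 2 ≤ (∫ y, h y ^ 2) * Torus.scalarL2Sq (θ t) := by
    filter_upwards [Torus.ae_integral_mul_eq_trace hθ hhs, Torus.ae_trace_sq_le hθ hhs] with t h1 h2
    rw [h1]; exact h2
  -- honesty of the three running means and a good horizon `N` beyond the largeness threshold `L`
  obtain ⟨R, hR⟩ := exists_forall_fluct_le hκ hgs hgz hLH hWc hWB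
  have hFb : IsBoundedUnder (· ≤ ·) atTop (timeMean fun t => ∫ x, ‖v t x - W t x‖ ^ 2) :=
    isBoundedUnder_le_timeMean (C := R) fun t ht => by rw [abs_of_nonneg (hF0 t)]; exact hR t ht.le
  have hEb := Torus.isBoundedUnder_timeMean_scalarL2Sq hκ hθ hθ₀ hhs hhz hG'
  set K : ℝ := ∫ t in (0 : ℝ)..S, ∫ s in (0 : ℝ)..t, ∫ x, θ s x * h x with hK
  set L : ℝ := (ε * S ^ 2 / 2 + S * (1 / 2 * ∫ y, θ₀ y ^ 2) + |K| + 1) / (3 / 4 * ε * S) with hL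
  have hshift : Tendsto (fun N : ℝ => N + S) atTop atTop := tendsto_atTop_add_const_right _ S tendsto_id
  have e1 : ∀ᶠ N in atTop, timeMean (fun t => Torus.scalarL2Sq (θ t)) N < Eθ := eventually_lt_of_limsup_lt hSlim hEb
  obtain ⟨N, hqN, hEN, hET, hFT, hLN⟩ := ((frequently_lt_of_lt_limsup (isCoboundedUnder_le_timeMean_of_nonneg hq0)
    hD).and_eventually (e1.and ((hshift.eventually e1).and ((hshift.eventually (eventually_lt_of_limsup_lt hFlim hFb)).and
    (eventually_ge_atTop (max 1 L)))))).exists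
  have hN : 0 < N := one_pos.trans_le ((le_max_left _ _).trans hLN)
  have hT : 0 < N + S := by linarith
  have hlarge : ε * S ^ 2 / 2 + S * (1 / 2 * ∫ y, θ₀ y ^ 2) + |K| < 3 / 4 * ε * S * N := by
    have h1 : L ≤ N := (le_max_right _ _).trans hLN
    rw [hL, div_le_iff₀ (by positivity)] at h1
    linarith
  -- the running means as integrals
  have mEN : ∫ s in (0 : ℝ)..N, Torus.scalarL2Sq (θ s) ≤ Eθ * N := by
    rw [Condensate.intervalIntegral_eq_mul_timeMean _ hN]; nlinarith
  have mET : ∫ s in (0 : ℝ)..(N + S), Torus.scalarL2Sq (θ s) ≤ Eθ * (N + S) := by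
    rw [Condensate.intervalIntegral_eq_mul_timeMean _ hT]; nlinarith
  have mFT : ∫ s in (0 : ℝ)..(N + S), (∫ x, ‖v s x - W s x‖ ^ 2) ≤ δ * (N + S) := by
    rw [Condensate.intervalIntegral_eq_mul_timeMean _ hT]; nlinarith
  -- `(H1)` turns the dissipation floor at `N` into a floor for the primitive of the power on `[N, N + S]`
  have hfloor : ∀ t ∈ Icc N (N + S), 2 * ε * N - 1 / 2 * (∫ y, θ₀ y ^ 2) ≤ ∫ s in (0 : ℝ)..t, ∫ x, θ s x * h x := by
    intro t ht
    have ht0 : 0 < t := hN.trans_le ht.1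
    have h1 := Torus.intervalIntegral_dissipationRate_le hκ hθ hθ₀ hhs hG' ht0
    have h2 : ∫ s in (0 : ℝ)..t, ((∫ y, θ₀ y * h y) + ∫ τ in Ioc 0 s, ((∫ y, θ τ y *
        (⟪v τ y, Torus.gradient h y⟫_ℝ + κ * Torus.laplacian h y)) + ∫ y, h y * h y)) = ∫ s in (0 : ℝ)..t, ∫ x, θ s x * h x := by
      rw [intervalIntegral.integral_of_le ht0.le, intervalIntegral.integral_of_le ht0.le]
      exact (integral_congr_ae (ae_restrict_of_ae_restrict_of_subset Ioc_subset_Ioi_self (Torus.ae_integral_mul_eq_trace hθ hhs))).symm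
    have h3 : ∫ s in (0 : ℝ)..N, κ * (Torus.eScalarGradNormSq (θ s)).toReal ≤ ∫ s in (0 : ℝ)..t, κ * (Torus.eScalarGradNormSq (θ s)).toReal :=
      intervalIntegral.integral_mono_interval le_rfl hN.le ht.1 (ae_of_all _ hq0)
        (AgeDecoupling.intervalIntegrable_of_forall_integrableOn hqi le_rfl ht0.le)
    have h4 : 2 * ε * N ≤ ∫ s in (0 : ℝ)..N, κ * (Torus.eScalarGradNormSq (θ s)).toReal := by
      rw [Condensate.intervalIntegral_eq_mul_timeMean _ hN]; nlinarith
    linarith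
  -- the penalised selection, then `16 (∫h²) Eθ/ε² ≤ λ`
  obtain ⟨a, haG, ha, g1, g2, g3, g4⟩ := exists_good_block hS hN hε hEθ hδ hH0 hPi hEi hFi hE0 hF0
    (fun a ha => sq_block_le hPi hEi hPE hS.le ha) hfloor mEN mET mFT hlarge hG
  refine ⟨a, haG, ha, g1, g2.trans (sub_nonneg.1 ?_), g3.trans (sub_nonneg.1 ?_), g4.trans (sub_nonneg.1 ?_)⟩
  · have e : (64 * (∫ y, h y ^ 2) * Eθ / ε ^ 2 + 4) * Eθ * S - 16 * S * (∫ y, h y ^ 2) * Eθ ^ 2 / ε ^ 2 =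
        48 * (S * (∫ y, h y ^ 2) * Eθ ^ 2 / ε ^ 2) + 4 * (Eθ * S) := by ring
    rw [e]; positivity
  · have e : (64 * (∫ y, h y ^ 2) * Eθ / ε ^ 2 + 4) * δ * S - 16 * S * (∫ y, h y ^ 2) * Eθ * δ / ε ^ 2 =
        48 * (S * (∫ y, h y ^ 2) * Eθ * δ / ε ^ 2) + 4 * (δ * S) := by ring
    rw [e]; positivity
  · have e : (64 * (∫ y, h y ^ 2) * Eθ / ε ^ 2 + 4) * Eθ - 16 * (∫ y, h y ^ 2) * Eθ ^ 2 / ε ^ 2 =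
        48 * ((∫ y, h y ^ 2) * Eθ ^ 2 / ε ^ 2) + 4 * Eθ := by ring
    rw [e]; positivity

end Summit.AnomalousDissipation.AnomalousDissipation.Theorems.TwohalfdNeg.RegularCondensate
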